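import Mathlib
import HarnessLib
import Summits.NavierStokesRegularity.NavierStokesRegularity.Theorems.WakeRatchetMinimalViscousBlowupThresholdContinuity

/-!
# Route `WakeRatchet`, crux `MinimalViscousBlowup` (stmt-NavierStokesRegularity-22743) — LINE g11-1 «threshold ray» (ns-idea-1 g11),
# stub S3b-α1 `stub_ceilingOffThreshold`: THE SUB-THRESHOLD CEILING OFF THE CRITICAL WINDOW

`ceilingOffThreshold` (binders VERBATIM from skeleton v3.7 30b76af2e7da9393): if every `ν' > ν` carries a global regular solution, then on the COMPACT
viscosity window `[ν+δ, 2ν]` the supercriticality envelope `λⁿ‖X'_n(t)‖²`, `t ≤ T₀`, is uniformly bounded by `S₁ν'²` over all global regular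
`ν'`-solutions.  CONTINUITY + COMPACTNESS: around each `ν₁` of the window the landed `weighted_continuity` ((E2): Grönwall in the weight `λ^{8k⁺}` with
bootstrap) pins every global `ν'`-solution, `|ν' − ν₁| < δ₁(ν₁)`, within `λ^{−8k⁺}` of the given `ν₁`-solution on `[0,T₀]`, whence
`λⁿ‖X'_n‖² ≤ 4(M₁+1)²`; finitely many such balls cover the window (`IsCompact.elim_nhds_subcover`).
MODEL lattice ODEs only; nothing here concerns the Navier–Stokes equations (no NS regularity statement is proved).
`--supports stmt-NavierStokesRegularity-22743 --as helper`.
[cite: Teschl2012, Thm. 2.8 (dependence on parameters); Tao2016AveragedNS, §4 Lemma 4.1 (4.5)]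
-/

noncomputable section

-- the summit and its single sub-problem share the name (CONVENTIONS §1)
set_option linter.dupNamespace false

open Set Filter Topology

namespace Summit.NavierStokesRegularity.NavierStokesRegularity.Theorems.MinimalViscousBlowup.ThresholdRay

open Literature.Analysis.FluidPDE Literature.Analysis.FluidPDE.TaoCascade

/-- **Local ceiling near a regular viscosity.**  If `ν₁ > 0` carries a global regular solution `X₁`, then every global regular `ν'`-solution with
`|ν' − ν₁| < δ₁` obeys `λⁿ‖X'_n(t)‖² ≤ 4(M₁+1)²` on `[0,T₀]` (`M₁` the (4.5) bound of `X₁` on `[0,T₀]`, `δ₁ = δ₁(M₁, T₀, λ)`), by (E2)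
`weighted_continuity`. [cite: Teschl2012, Thm. 2.8; Tao2016AveragedNS, §4 Lemma 4.1 (4.5)] -/
theorem local_ceiling {ε₀ ν₁ R T₀ : ℝ} (hε : 0 < ε₀) (hT₀ : 0 < T₀)
    {α : Fin 4 → Fin 4 → Fin 4 → ℤ × ℤ × ℤ → ℝ} (hα : InTableClass R α) {X₀ : Fin 4 → ℝ} {X₁ : Fin 4 → ℤ → ℝ → ℝ}
    (hX₁ : ViscousGlobal ε₀ ν₁ α X₀ X₁) :
    ∃ δ₁ : ℝ, 0 < δ₁ ∧ ∃ B : ℝ, 0 ≤ B ∧ ∀ ν' : ℝ, |ν' - ν₁| < δ₁ → 0 ≤ ν' →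
      ∀ X' : Fin 4 → ℤ → ℝ → ℝ, ViscousGlobal ε₀ ν' α X₀ X' →
        ∀ (n : ℤ) (t : ℝ), 0 ≤ t → t ≤ T₀ → (1 + ε₀) ^ n * ‖shellVec X' n t‖ ^ 2 ≤ B := by
  have hl0 : (0 : ℝ) < 1 + ε₀ := by linarith
  have hl1 : (1 : ℝ) ≤ 1 + ε₀ := by linarith
  have hα' : ∀ i₁ i₂ i₃ μ, |restrictShiftSet α i₁ i₂ i₃ μ| ≤ 1 :=
    abs_restrictShiftSet_le zero_le_one (abs_le_one_of_inTableClass hα)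
  obtain ⟨M₀, hM₀⟩ := hX₁.apriori T₀ hT₀
  set M : ℝ := max M₀ 0 with hMdef
  have hM0 : 0 ≤ M := le_max_right _ _
  have hM : ∀ t ∈ Icc (0 : ℝ) T₀, ∀ (i : Fin 4) (k : ℤ), (1 + (1 + ε₀) ^ ((10 : ℝ) * k)) * |X₁ i k t| ≤ M :=
    fun t ht i k => (hM₀ t ht i k).trans (le_max_left _ _)
  have hXd : ∀ (i : Fin 4) (k : ℤ), ∀ t ∈ Icc 0 T₀, HasDerivWithinAt (X₁ i k)
      (quadTerm ε₀ (restrictShiftSet α) X₁ i k t - ν₁ * (1 + ε₀) ^ ((2 : ℝ) * k) * X₁ i k t) (Icc 0 T₀) t := by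
    intro i k t ht
    have h := ((hX₁.contDiffOn i k).differentiableOn one_ne_zero t (show t ∈ Ici (0 : ℝ) from ht.1)).hasDerivWithinAt
    rw [hX₁.motion i k t ht.1, ← quadTerm_restrictShiftSet] at h
    exact h.mono fun u hu => hu.1
  set Cg : ℝ := 2 ^ (⌈T₀ * (16 * ((4 : ℕ) : ℝ) ^ 2 * 1 * (1 + ε₀) ^ (10 : ℝ) * (M + 2) + 1)⌉₊ + 1) * M with hCg
  have hCg0 : 0 ≤ Cg := by rw [hCg]; positivity
  refine ⟨1 / (Cg + 1), by positivity, 4 * (M + 1) ^ 2, by positivity, ?_⟩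
  intro ν' hν'ν₁ hν'0 X' hX' n t ht0 htT₀
  have hsmall : Cg * |ν' - ν₁| ≤ 1 := by
    calc Cg * |ν' - ν₁| ≤ Cg * (1 / (Cg + 1)) := mul_le_mul_of_nonneg_left hν'ν₁.le hCg0
      _ = Cg / (Cg + 1) := by ring
      _ ≤ 1 := by rw [div_le_one (by positivity)]; linarith
  have hYd : ∀ (i : Fin 4) (k : ℤ), ∀ t ∈ Icc 0 T₀, HasDerivWithinAt (X' i k)
      (quadTerm ε₀ (restrictShiftSet α) X' i k t - ν' * (1 + ε₀) ^ ((2 : ℝ) * k) * X' i k t) (Icc 0 T₀) t := by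
    intro i k t ht
    have h := ((hX'.contDiffOn i k).differentiableOn one_ne_zero t (show t ∈ Ici (0 : ℝ) from ht.1)).hasDerivWithinAt
    rw [hX'.motion i k t ht.1, ← quadTerm_restrictShiftSet] at h
    exact h.mono fun u hu => hu.1
  obtain ⟨M', hM'⟩ := hX'.apriori T₀ hT₀
  have hD := weighted_continuity (m := 4) (S := T₀) hε zero_le_one hα' hν'0 hM0 one_pos le_rfl le_rfl
    (fun i k => by rw [hX₁.init, hX'.init]) (fun i k hk t ht => hX₁.noLow i k t hk ht.1)
    (fun i k hk t ht => hX'.noLow i k t hk ht.1) hM ⟨M', fun t ht i k => hM' t ht i k⟩ hXd hYd hsmall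
  have htw : t ∈ Icc (0 : ℝ) T₀ := ⟨ht0, htT₀⟩
  rcases lt_or_ge n 0 with hn | hn
  · have h0 : shellVec X' n t = 0 := by
      ext j
      simp [shellVec_apply, hX'.noLow j n t hn ht0]
    rw [h0, norm_zero]
    simp only [ne_eq, OfNat.ofNat_ne_zero, not_false_eq_true, zero_pow, mul_zero]
    positivity
  · obtain ⟨k, rfl⟩ := Int.eq_ofNat_of_zero_le hn
    rw [zpow_natCast]
    set P : ℝ := (1 + ε₀) ^ k with hP
    have hP0 : 0 < P := pow_pos hl0 k
    have hP1 : 1 ≤ P := one_le_pow₀ hl1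
    have hcomp : ∀ i : Fin 4, |X' i k t| ≤ (M + 1) / P := by
      intro i
      have h1 := hM t htw i k
      have hw1 : (1 + ε₀) ^ ((10 : ℝ) * ((k : ℕ) : ℤ)) = P ^ 10 := by
        rw [show ((10 : ℝ) * (((k : ℕ) : ℤ) : ℝ)) = ((k * 10 : ℕ) : ℝ) by push_cast; ring, Real.rpow_natCast, pow_mul]
      rw [hw1] at h1
      have h2 := hD t htw i k
      rw [max_eq_left (by positivity : (0 : ℤ) ≤ (k : ℤ))] at h2
      have hw2 : (1 + ε₀) ^ ((8 : ℝ) * (((k : ℕ) : ℤ) : ℝ)) = P ^ 8 := by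
        rw [show ((8 : ℝ) * (((k : ℕ) : ℤ) : ℝ)) = ((k * 8 : ℕ) : ℝ) by push_cast; ring, Real.rpow_natCast, pow_mul]
      rw [hw2] at h2
      have hP10 : P ≤ P ^ 10 := le_self_pow₀ hP1 (by norm_num)
      have hP8 : P ≤ P ^ 8 := le_self_pow₀ hP1 (by norm_num)
      have htri : |X' i k t| ≤ |X₁ i k t| + |X' i k t - X₁ i k t| := by
        have := abs_add_le (X₁ i k t) (X' i k t - X₁ i k t); rwa [add_sub_cancel] at this
      rw [le_div_iff₀ hP0]
      have e1 : |X₁ i (k : ℤ) t| * P ≤ M := by nlinarith [abs_nonneg (X₁ i k t)]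
      have e2 : |X' i (k : ℤ) t - X₁ i k t| * P ≤ 1 := by nlinarith [abs_nonneg (X' i k t - X₁ i k t)]
      nlinarith [abs_nonneg (X' i k t)]
    have hnorm := norm_shellVec_le_two_mul (by positivity) hcomp
    have hsq : ‖shellVec X' (k : ℤ) t‖ ^ 2 ≤ (2 * ((M + 1) / P)) ^ 2 := pow_le_pow_left₀ (norm_nonneg _) hnorm 2
    calc P * ‖shellVec X' (k : ℤ) t‖ ^ 2 ≤ P * (2 * ((M + 1) / P)) ^ 2 := mul_le_mul_of_nonneg_left hsq hP0.le
      _ = 4 * (M + 1) ^ 2 / P := by field_simp; norm_num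
      _ ≤ 4 * (M + 1) ^ 2 := div_le_self (by positivity) hP1

/-- **S3b-α1 `stub_ceilingOffThreshold` (LINE g11-1 v3.7, binders VERBATIM) — THE CEILING OFF THE CRITICAL WINDOW.**  For a table of the class
`E₂(R)` and `ν > 0` above which every viscosity is regular, the envelope `λⁿ‖X'_n(t)‖²` (`t ≤ T₀`) of the global regular solutions at viscosities
`ν' ∈ [ν+δ, 2ν]` is bounded by `S₁ν'²` (continuity `local_ceiling` + compactness of the window).  MODEL lattice only.
[cite: Teschl2012, Thm. 2.8; Tao2016AveragedNS, §4 Lemma 4.1 (4.5)] -/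
theorem ceilingOffThreshold : ∀ ε₀ : ℝ, 0 < ε₀ → ∀ R : ℝ, 1 ≤ R →
    ∀ (α : Fin 4 → Fin 4 → Fin 4 → ℤ × ℤ × ℤ → ℝ) (X₀ : Fin 4 → ℝ),
    Literature.Analysis.FluidPDE.TaoCascade.InTableClass R α →
    ∀ ν : ℝ, 0 < ν →
    (∀ ν' : ℝ, ν < ν' →
      ∃ X : Fin 4 → ℤ → ℝ → ℝ, Literature.Analysis.FluidPDE.TaoCascade.ViscousGlobal ε₀ ν' α X₀ X) →
    ∀ δ : ℝ, 0 < δ → ∀ T₀ : ℝ, 0 < T₀ →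
    ∃ S₁ : ℝ, ∀ ν' : ℝ, ν + δ ≤ ν' → ν' ≤ 2 * ν → ∀ X' : Fin 4 → ℤ → ℝ → ℝ,
      Literature.Analysis.FluidPDE.TaoCascade.ViscousGlobal ε₀ ν' α X₀ X' →
      ∀ (n : ℤ) (t : ℝ), 0 ≤ t → t ≤ T₀ →
        (1 + ε₀) ^ n * ‖Literature.Analysis.FluidPDE.TaoCascade.shellVec X' n t‖ ^ 2 ≤ S₁ * ν' ^ 2 := by
  intro ε₀ hε R _hR α X₀ hα ν hν habove δ hδ T₀ hT₀
  -- local ceilings around each viscosity of the window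
  have key : ∀ ν₁ ∈ Icc (ν + δ) (2 * ν), ∃ δ₁ : ℝ, 0 < δ₁ ∧ ∃ B : ℝ, 0 ≤ B ∧ ∀ ν' : ℝ, |ν' - ν₁| < δ₁ → 0 ≤ ν' →
      ∀ X' : Fin 4 → ℤ → ℝ → ℝ, ViscousGlobal ε₀ ν' α X₀ X' →
        ∀ (n : ℤ) (t : ℝ), 0 ≤ t → t ≤ T₀ → (1 + ε₀) ^ n * ‖shellVec X' n t‖ ^ 2 ≤ B := by
    intro ν₁ hν₁
    obtain ⟨X₁, hX₁⟩ := habove ν₁ (by linarith [hν₁.1])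
    exact local_ceiling hε hT₀ hα hX₁
  choose! δ₁ hδ₁ B hB0 hB using key
  obtain ⟨tF, htF, hcover⟩ := (isCompact_Icc : IsCompact (Icc (ν + δ) (2 * ν))).elim_nhds_subcover
    (fun x => Metric.ball x (δ₁ x)) (fun x hx => Metric.ball_mem_nhds x (hδ₁ x hx))
  refine ⟨(∑ x ∈ tF, B x) / (ν + δ) ^ 2, ?_⟩
  intro ν' h1 h2 X' hX' n t ht0 htT₀
  have hmem : ν' ∈ Icc (ν + δ) (2 * ν) := ⟨h1, h2⟩
  have hcov := hcover hmem
  simp only [mem_iUnion] at hcov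
  obtain ⟨x, hx, hball⟩ := hcov
  have hxI := htF x hx
  have hdist : |ν' - x| < δ₁ x := by rwa [Metric.mem_ball, Real.dist_eq] at hball
  have hb := hB x hxI ν' hdist (by linarith) X' hX' n t ht0 htT₀
  have hsum : B x ≤ ∑ y ∈ tF, B y := Finset.single_le_sum (fun y hy => hB0 y (htF y hy)) hx
  have hS0 : 0 ≤ ∑ y ∈ tF, B y := Finset.sum_nonneg fun y hy => hB0 y (htF y hy)
  have hνδ : 0 < ν + δ := by linarith
  have hsq : (ν + δ) ^ 2 ≤ ν' ^ 2 := pow_le_pow_left₀ hνδ.le h1 2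
  calc (1 + ε₀) ^ n * ‖shellVec X' n t‖ ^ 2 ≤ ∑ y ∈ tF, B y := hb.trans hsum
    _ = (∑ y ∈ tF, B y) / (ν + δ) ^ 2 * (ν + δ) ^ 2 := by field_simp
    _ ≤ (∑ y ∈ tF, B y) / (ν + δ) ^ 2 * ν' ^ 2 := mul_le_mul_of_nonneg_left hsq (by positivity)

/-- Alias under the skeleton's stub name (LINE g11-1 v3.7 `stub_ceilingOffThreshold`). [folklore] -/
theorem stub_ceilingOffThreshold : ∀ ε₀ : ℝ, 0 < ε₀ → ∀ R : ℝ, 1 ≤ R →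
    ∀ (α : Fin 4 → Fin 4 → Fin 4 → ℤ × ℤ × ℤ → ℝ) (X₀ : Fin 4 → ℝ),
    Literature.Analysis.FluidPDE.TaoCascade.InTableClass R α →
    ∀ ν : ℝ, 0 < ν →
    (∀ ν' : ℝ, ν < ν' →
      ∃ X : Fin 4 → ℤ → ℝ → ℝ, Literature.Analysis.FluidPDE.TaoCascade.ViscousGlobal ε₀ ν' α X₀ X) →
    ∀ δ : ℝ, 0 < δ → ∀ T₀ : ℝ, 0 < T₀ →
    ∃ S₁ : ℝ, ∀ ν' : ℝ, ν + δ ≤ ν' → ν' ≤ 2 * ν → ∀ X' : Fin 4 → ℤ → ℝ → ℝ,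
      Literature.Analysis.FluidPDE.TaoCascade.ViscousGlobal ε₀ ν' α X₀ X' →
      ∀ (n : ℤ) (t : ℝ), 0 ≤ t → t ≤ T₀ →
        (1 + ε₀) ^ n * ‖Literature.Analysis.FluidPDE.TaoCascade.shellVec X' n t‖ ^ 2 ≤ S₁ * ν' ^ 2 :=
  ceilingOffThreshold

end Summit.NavierStokesRegularity.NavierStokesRegularity.Theorems.MinimalViscousBlowup.ThresholdRay

end
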